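import Literature.AlgebraicGeometry.Motives.SeesawCohomologyBaseChange
import Literature.AlgebraicGeometry.Motives.CartierDivisorCocycleIntegral
import Literature.AlgebraicGeometry.Motives.RatFnFlatDescent
import Literature.AlgebraicGeometry.Motives.ThickeningModel
import Literature.AlgebraicGeometry.Morphisms.GenericFibreSmooth
import HarnessLib

/-!
# A line bundle trivial on the generic fibre of `X ×_K T → T` is trivial over a dense open of `T`

For `K` a field, `X → Spec K` proper and geometrically integral, `T` an integral `K`-scheme and a
Cartier divisor `D` on the integral scheme `X ×_K T`, this file PROVES
(`CartierDivisor.exists_isTrivialOver_of_genericPoint_mem_trivialLocus`): **if the generic point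
`η` of `T` lies in the trivial locus `Z(D) = {t ; 𝒪(D)|_{X_t} ≅ 𝒪}` (`CartierDivisor.trivialLocus`,
`Motives/SeesawTheorem`), then `𝒪(D)` is trivial over an open neighbourhood `U` of `η`**
(`CartierDivisor.IsTrivialOver`, `Motives/CartierDivisorPullbackFromBase`), i.e. `D|_{pr_T⁻¹U}` is
principal. This is the elementary "spreading out from the generic fibre" (The Stacks Project,
Tag 01ZR / Lemma 0B8W: `Pic` of a limit of schemes is the colimit of the `Pic`'s, injectivity,
applied to `X_η = lim_U X ×_K U`; Görtz–Wedhorn I, Thm. 10.60 / Exercise 10.32 (b)), proved here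
directly in the language of rational functions:

* the inclusion of the generic fibre `ι : X_η = X ×_K Spec κ(η) → X ×_K T` is a dominant flat
  preimmersion (flatness of `Spec κ(η) → T`: `Morphisms/GenericFibreSmooth`), hence induces a
  bijection of function fields (`functionFieldMap_genericFibreι_bijective`: the stalk maps of a
  flat preimmersion are faithfully flat and surjective, as in `Motives/GenericFibreRatSpread`);
* a trivialisation `(σ_i)` of `𝒪(D)` along `ι` (`mem_trivialLocus_iff_trivialAlong`) therefore
  defines ONE rational function `s ∈ K(X × T)` with `ι^♯(f_i s) = σ_i` (cocycle condition at the
  generic point), and `f_i s` is a unit at every point of the generic fibre — regularity descends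
  along the flat `ι` (`RatFn.IsRegularAt.of_functionFieldMap`, `Motives/RatFnFlatDescent`) and
  units are detected by the local stalk maps;
* the locus where `s` generates `𝒪(D)` is open and contains the generic fibre, `pr_T` is closed
  (`X` proper), so it contains `pr_T⁻¹U` for an open `U ∋ η` — the argument of Görtz–Wedhorn II,
  proof of Thm. 24.66 (2), p. 546, exactly as in
  `CartierDivisor.isTrivialOver_of_isSectionOver_of_mem_trivialLocus`
  (`Motives/SeesawCohomologyBaseChange`).

No cohomology, no named facts. Used by the codimension descent proving the theorem of the square
for abelian varieties (`Motives/AbelianVarietySquareOfGenericCube`). Mathlib searched (pin):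
`MorphismProperty.IsStableUnderBaseChange.of_isPullback`,
`Module.FaithfullyFlat.of_flat_of_isLocalHom`, `Scheme.Hom.stalkMap_surjective` (used).

## References

* The Stacks Project, Tag 0B8W (Limits of Schemes, Lemma 32.10.2/10.3: descending invertible
  modules and isomorphisms along limits) and Tag 01ZR. [StacksProject]
* U. Görtz, T. Wedhorn, *Algebraic Geometry I: Schemes*, 2nd ed. (2020): Thm. 10.60 (p. 326),
  Exercise 10.32 (b) (p. 353). [GortzWedhorn2020]
* U. Görtz, T. Wedhorn, *Algebraic Geometry II* (2023): Thm. 24.66 (2), proof (p. 546).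
  [GortzWedhorn2023]
-/

universe u

open CategoryTheory CategoryTheory.Limits AlgebraicGeometry MonoidalCategory
open CartesianMonoidalCategory
open Literature.AlgebraicGeometry.Motives.RatFn

noncomputable section

namespace Literature.AlgebraicGeometry.Motives

variable {K : Type u} [Field K]

/-! ### The generic fibre inclusion is a dominant flat preimmersion, birational -/

section GenericFibre

variable (X T : SchemeOver K) [IsIntegral T.left]

/-- The inclusion `ι_η : X_η = X ×_K Spec κ(η) → X ×_K T` of the generic fibre of `pr_T`
(an `abbrev` for `(X ◁ residuePtι T η).left`, `Motives/SeesawTheorem`). [folklore] -/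
abbrev genericFibreι : (X ⊗ residuePt T (genericPoint T.left)).left ⟶ (X ⊗ T).left :=
  (X ◁ residuePtι T (genericPoint T.left)).left

/-- The inclusion of the generic fibre is flat (base change of the flat `Spec κ(η) → T`,
`Literature.AlgebraicGeometry.Morphisms.flat_fromSpecResidueField_genericPoint`). [folklore] -/
instance flat_genericFibreι : Flat (genericFibreι X T) := by
  haveI : Flat (residuePtι T (genericPoint T.left)).left :=
    Literature.AlgebraicGeometry.Morphisms.flat_fromSpecResidueField_genericPoint T.left
  exact MorphismProperty.of_isPullback (P := @Flat)
    (isPullback_whiskerLeft X (residuePtι T (genericPoint T.left))).flip inferInstance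

omit [IsIntegral T.left] in
/-- The inclusion `X_t → X ×_K T` of any fibre is a preimmersion (base change of
`Spec κ(t) → T`). [folklore] -/
instance isPreimmersion_fibreι (t : T.left) : IsPreimmersion (X ◁ residuePtι T t).left := by
  haveI : IsPreimmersion (residuePtι T t).left :=
    inferInstanceAs (IsPreimmersion (T.left.fromSpecResidueField t))
  exact MorphismProperty.of_isPullback (P := @IsPreimmersion)
    (isPullback_whiskerLeft X (residuePtι T t)).flip inferInstance

variable [GeometricallyIntegral X.hom] [IsIntegral (X ⊗ T).left]

/-- `pr_T` maps the generic point of `X ×_K T` to the generic point of `T`. [folklore] -/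
theorem snd_left_genericPoint :
    (snd X T).left (genericPoint (X ⊗ T).left) = genericPoint T.left := by
  haveI : Surjective (snd X T).left := inferInstanceAs (Surjective (pullback.snd X.hom T.hom))
  exact genericPoint_eq_of_isDominant _

/-- The inclusion of the generic fibre is dominant (its image, the fibre over `η`, contains the
generic point of `X ×_K T`). [folklore] -/
instance isDominant_genericFibreι : IsDominant (genericFibreι X T) := by
  obtain ⟨ζ', hζ'⟩ := exists_whiskerLeft_residuePtι_apply_eq (snd_left_genericPoint X T)
  exact ⟨dense_of_genericPoint_mem ⟨ζ', hζ'⟩⟩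

/-- **The generic fibre inclusion induces a bijection of function fields** `K(X × T) ≅ K(X_η)`:
a dominant flat preimmersion has bijective stalk maps (surjective: preimmersion; injective: a flat
local homomorphism is faithfully flat), in particular at the generic point. [folklore] -/
theorem functionFieldMap_genericFibreι_bijective :
    Function.Bijective (functionFieldMap (genericFibreι X T)) := by
  have hη : genericFibreι X T (genericPoint _) = genericPoint (X ⊗ T).left :=
    genericPoint_eq_of_isDominant (genericFibreι X T)
  haveI : IsIso ((X ⊗ T).left.presheaf.stalkSpecializes
      (specializes_genericPoint (genericFibreι X T))) := by
    have key : ∀ (y : (X ⊗ T).left) (h : y ⤳ genericPoint (X ⊗ T).left),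
        y = genericPoint (X ⊗ T).left → IsIso ((X ⊗ T).left.presheaf.stalkSpecializes h) := by
      rintro y h rfl
      rw [show (X ⊗ T).left.presheaf.stalkSpecializes h = 𝟙 _ from
        TopCat.Presheaf.stalkSpecializes_refl _ _]
      infer_instance
    exact key _ _ hη
  have h2 : Function.Bijective ((genericFibreι X T).stalkMap (genericPoint _)) := by
    refine ⟨?_, (genericFibreι X T).stalkMap_surjective _⟩
    letI := ((genericFibreι X T).stalkMap (genericPoint _)).hom.toAlgebra
    haveI : Module.Flat ((X ⊗ T).left.presheaf.stalk (genericFibreι X T (genericPoint _)))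
        ((X ⊗ residuePt T (genericPoint T.left)).left.presheaf.stalk (genericPoint _)) :=
      Flat.stalkMap (genericFibreι X T) _
    haveI : IsLocalHom (algebraMap
        ((X ⊗ T).left.presheaf.stalk (genericFibreι X T (genericPoint _)))
        ((X ⊗ residuePt T (genericPoint T.left)).left.presheaf.stalk (genericPoint _))) :=
      inferInstanceAs (IsLocalHom ((genericFibreι X T).stalkMap (genericPoint _)).hom)
    haveI : Module.FaithfullyFlat
        ((X ⊗ T).left.presheaf.stalk (genericFibreι X T (genericPoint _)))
        ((X ⊗ residuePt T (genericPoint T.left)).left.presheaf.stalk (genericPoint _)) :=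
      Module.FaithfullyFlat.of_flat_of_isLocalHom
    exact FaithfulSMul.algebraMap_injective
      ((X ⊗ T).left.presheaf.stalk (genericFibreι X T (genericPoint _)))
      ((X ⊗ residuePt T (genericPoint T.left)).left.presheaf.stalk (genericPoint _))
  exact h2.comp (ConcreteCategory.bijective_of_isIso
    ((X ⊗ T).left.presheaf.stalkSpecializes (specializes_genericPoint (genericFibreι X T))))

end GenericFibre

/-! ### Spreading out a trivialisation from the generic fibre -/

/-- **`𝒪(D)` trivial on the generic fibre is trivial over a dense open of the base** (The Stacks
Project, Tag 0B8W (injectivity of `Pic` along `X_η = lim X ×_K U`); Görtz–Wedhorn II, proof of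
Thm. 24.66 (2), p. 546, for the last step): for `X → Spec K` proper geometrically integral, `T` an
integral `K`-scheme, `D` a Cartier divisor on the integral `X ×_K T` with `η_T ∈ Z(D)`, there is an
open `U ∋ η_T` with `D|_{pr_T⁻¹U}` principal (`CartierDivisor.IsTrivialOver`). Proof: a
trivialisation `(σ_i)` along the generic fibre `ι : X_η → X × T` (a dominant flat preimmersion, so
`ι^♯ : K(X × T) ≅ K(X_η)`) is `σ_i = ι^♯(f_i s)` for one `s ∈ K(X × T)^×` (take `s = e/f_{i₀}` with
`ι^♯ e = σ_{i₀}` and use the cocycle condition at the generic point); `f_i s` is then a unit at every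
point of the generic fibre (flat descent of regularity, local stalk maps), i.e. `E = D + div(s)`
avoids the fibre over `η`; `{E avoids}` is open and `pr_T` is closed.
[cite: StacksProject, Tag 0B8W] [cite: GortzWedhorn2023, Thm. 24.66 (2), proof (p. 546)] -/
theorem CartierDivisor.exists_isTrivialOver_of_genericPoint_mem_trivialLocus (X T : SchemeOver K)
    [IsProper X.hom] [GeometricallyIntegral X.hom] [IsIntegral T.left] [IsIntegral (X ⊗ T).left]
    {D : CartierDivisor (X ⊗ T).left}
    (hD : genericPoint T.left ∈ CartierDivisor.trivialLocus X T D) :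
    ∃ U : T.left.Opens, genericPoint T.left ∈ U ∧ D.IsTrivialOver (snd X T).left U := by
  have hτ : D.TrivialAlong (genericFibreι X T) := mem_trivialLocus_iff_trivialAlong.1 hD
  obtain ⟨τ⟩ := hτ
  have hbij := functionFieldMap_genericFibreι_bijective X T
  have hgen : genericFibreι X T (genericPoint _) = genericPoint (X ⊗ T).left :=
    genericPoint_eq_of_isDominant _
  -- a chart through the generic point, and the rational function `s`
  obtain ⟨i₀, hi₀⟩ := D.covers (genericPoint (X ⊗ T).left)
  have hgen₀ : genericPoint (X ⊗ residuePt T (genericPoint T.left)).left ∈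
      genericFibreι X T ⁻¹ᵁ D.U i₀ := by
    change genericFibreι X T (genericPoint _) ∈ D.U i₀; rw [hgen]; exact hi₀
  obtain ⟨e, he⟩ := hbij.2 (ofSection hgen₀ (τ.σ i₀))
  -- `ι^♯(f_i s) = σ_i` for `s = e / f_{i₀}`, hence `f_i s` is a unit along the generic fibre
  have key : ∀ (i : D.ι) (v : (X ⊗ residuePt T (genericPoint T.left)).left),
      genericFibreι X T v ∈ D.U i → IsUnitAt (genericFibreι X T v) (D.f i * (e * (D.f i₀)⁻¹)) := by
    intro i v hv
    have hvi : genericPoint (X ⊗ residuePt T (genericPoint T.left)).left ∈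
        genericFibreι X T ⁻¹ᵁ D.U i :=
      genericPoint_mem_of_mem (show v ∈ genericFibreι X T ⁻¹ᵁ D.U i from hv)
    have hV12 : genericPoint (X ⊗ residuePt T (genericPoint T.left)).left ∈
        genericFibreι X T ⁻¹ᵁ D.U i ⊓ genericFibreι X T ⁻¹ᵁ D.U i₀ := ⟨hvi, hgen₀⟩
    -- the cocycle condition at the generic point of the fibre
    have hcoc := congrArg (ofSection hV12) (τ.cocycle i i₀)
    simp only [ofSection_map, map_mul] at hcoc
    have hA : ofSection hV12 ((genericFibreι X T).appLE (D.U i ⊓ D.U i₀)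
        (genericFibreι X T ⁻¹ᵁ D.U i ⊓ genericFibreι X T ⁻¹ᵁ D.U i₀) (D.preimage_inf_le _ i i₀)
        (D.transFun i i₀)) = functionFieldMap (genericFibreι X T) (D.f i / D.f i₀) := by
      rw [ofSection_appLE (genericFibreι X T) (D.preimage_inf_le _ i i₀) hV12 (D.transFun i i₀),
        ofSection_transFun, pullbackFn_eq_functionFieldMap]
    have hcoc' : ofSection hvi (τ.σ i) =
        functionFieldMap (genericFibreι X T) (D.f i / D.f i₀) * ofSection hgen₀ (τ.σ i₀) := by
      rw [← hA]; exact hcoc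
    have hfs : functionFieldMap (genericFibreι X T) (D.f i * (e * (D.f i₀)⁻¹)) =
        ofSection hvi (τ.σ i) := by
      rw [hcoc', ← he, ← map_mul]
      congr 1
      field_simp [D.f_ne_zero i₀]
    have hu : IsUnitAt v (functionFieldMap (genericFibreι X T) (D.f i * (e * (D.f i₀)⁻¹))) := by
      rw [hfs]
      exact isUnitAt_ofSection_of_isUnit (τ.isUnit i) hv
    exact (IsRegularAt.of_functionFieldMap (genericFibreι X T) hu.isRegularAt).isUnitAt_of_functionFieldMap hu
  -- `s ≠ 0`
  obtain ⟨ζ', hζ'⟩ := exists_whiskerLeft_residuePtι_apply_eq (snd_left_genericPoint X T)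
  have hs0 : e * (D.f i₀)⁻¹ ≠ 0 := by
    intro h0
    have hu := key i₀ ζ' (by rw [show genericFibreι X T ζ' = genericPoint _ from hζ']; exact hi₀)
    rw [h0, mul_zero] at hu
    exact hu.ne_zero rfl
  -- `E = D + div(s)` avoids every point over `η`
  have hfib : ∀ w : (X ⊗ T).left, (snd X T).left w = genericPoint T.left →
      (D + principal (e * (D.f i₀)⁻¹) hs0).Avoids w := by
    intro w hw
    obtain ⟨v, rfl⟩ := exists_whiskerLeft_residuePtι_apply_eq hw
    intro p hp
    rw [show (D + principal (e * (D.f i₀)⁻¹) hs0).f p = D.f p.1 * (e * (D.f i₀)⁻¹) from rfl]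
    exact key p.1 v hp.1
  -- the avoided locus is open and contains `pr_T⁻¹U` for an open `U ∋ η`, `pr_T` being closed
  have hVo : IsOpen {x : (X ⊗ T).left | (D + principal (e * (D.f i₀)⁻¹) hs0).Avoids x} := by
    rw [setOf_avoids_eq_nonvanishing]; exact isOpen_nonvanishing _ 1
  haveI : UniversallyClosed (snd X T).left :=
    inferInstanceAs (UniversallyClosed (pullback.snd X.hom T.hom))
  have hWc : IsClosed ((snd X T).left ''
      {x : (X ⊗ T).left | (D + principal (e * (D.f i₀)⁻¹) hs0).Avoids x}ᶜ) :=
    (snd X T).left.isClosedMap _ hVo.isClosed_compl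
  refine ⟨⟨_, hWc.isOpen_compl⟩, ?_, (e * (D.f i₀)⁻¹)⁻¹, inv_ne_zero hs0, fun i x hi hxW => ?_⟩
  · rintro ⟨x, hx, hxt⟩
    exact hx (hfib x hxt)
  · rw [div_inv_eq_mul]
    have hxV : (D + principal (e * (D.f i₀)⁻¹) hs0).Avoids x := by
      by_contra hx
      exact hxW ⟨x, hx, rfl⟩
    exact hxV (i, PUnit.unit) ⟨hi, trivial⟩

end Literature.AlgebraicGeometry.Motives

end
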